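import Mathlib
import Summits.Ventures.PercRepro.TriangleCapRowBCorner
import Summits.Ventures.PercRepro.TriangleCapFourRowFourT

/-!
# PercRepro — THE ROW `r = a` OF THE STABILITY TABLE AT A GENERAL `a`, THE PIECES: the window, the sides of an
`a`-bipartite `D − z` (the all-off read is the broom-`B2` bound, exactly the target), and the deletion arithmetic at
the target `Σ_v d(v)² + a (k − 1 − a) + 2 (k − a − 3) ≤ m k` (p3, gen 47; part 200o)

On the cell `(k, a, a)` the family `B2` does not exist (its star would isolate a vertex), and the non-bipartite second
best is conjectured to be the broom-`B2` family, `K_{a+1,k−a−1}` minus a BROOM of `k − a − 1` pairs, `2 (k − a − 3)`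
below the closed form (strictly below the one-triangle family `T = 2k − 14` for `a ≥ 5`). With no vertex at the cap,
every degree `≥ a` gives the target by the window (`rowA_window`); an `a`-bipartite `D − z` with every neighbour of
`z` off the side makes `D` `(a + 1)`-bipartite with `k − a − 1` missing pairs that are NOT a star (a missing pair of
`D − z` and two non-neighbours of `z`: `not_missingStar_insert`), so `closed_form_stability_bipSub` gives EXACTLY the
target (`sides_A_gen`); a mixed neighbourhood has `2 ≤ d(z)` and `T + (k − a − 2) ≤ d (k − a − 2) + a`. The
deletions of a vertex of degree `d ≤ a − 1` land on `(k − 1, a, d)`: the diagonal (`rowA_del_zero`), a `B2` cell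
(`rowA_del_B2`, slack `2e (6 + c − e + 2q)`), the `T` cell (`rowA_del_T`, slack `4 + 2q`), the `B2` cell `r′ = a − 1`
(`rowA_del_B`, slack `0`); the mixed arithmetic `rowA_mixed` (slack `2e (3 + q − e)`). Axioms: standard.
-/

namespace PercRepro

namespace TriangleCap

namespace C047

open Finset

variable {V : Type*} [Fintype V] [DecidableEq V]

omit [DecidableEq V] in
/-- **THE WINDOW `[a, k − a − 1]` ON `(k, a, a)`:** every degree in `[a, k − a − 1]` gives
`Σ_v d(v)² + a (k − 1 − a) + 2 (k − a − 3) ≤ m k` (`3 ≤ a`, `2a + 1 ≤ k`). -/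
theorem rowA_window (D : SimpleGraph V) [DecidableRel D.Adj] (a : ℕ) (ha3 : 3 ≤ a)
    (hk : 2 * a + 1 ≤ Fintype.card V) (hm : D.edgeFinset.card + a = a * (Fintype.card V - a))
    (hcap : ∀ v, deg D v + a + 1 ≤ Fintype.card V) (hdeg : ∀ v, a ≤ deg D v) :
    ∑ v, deg D v * deg D v + a * (Fintype.card V - 1 - a) + 2 * (Fintype.card V - a - 3) ≤
      D.edgeFinset.card * Fintype.card V := by
  have h := below_window_gen D a a (le_refl a) hk hm hcap hdeg
  have h2 : 2 * (Fintype.card V - 2 * a) ≤ a * (Fintype.card V - 2 * a) := Nat.mul_le_mul_right _ (by omega)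
  have h3 : 2 * (a - 1) ≤ a * (a - 1) := Nat.mul_le_mul_right _ (by omega)
  omega

/-- **THE SIDES OF AN `a`-BIPARTITE `D − z` ON THE CELL `(k, a, a)`, `3 ≤ a`, `3a ≤ k`:** `D` is `a`-bipartite, or
at the target (all neighbours of `z` off the side: `(a + 1)`-bipartite with `k − a − 1` missing pairs which are not a
star; `d(z) ≤ a − 1`), or `2 ≤ d(z)`, a neighbour of `z` lies off the side and `T + (k − a − 2) ≤ d(z) (k − a − 2) + a`. -/
theorem sides_A_gen (D : SimpleGraph V) [DecidableRel D.Adj] (a : ℕ) (ha3 : 3 ≤ a)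
    (hk : 3 * a ≤ Fintype.card V) (hm : D.edgeFinset.card + a = a * (Fintype.card V - a)) (z : V)
    (hz : deg D z + 1 ≤ a) (A' : Finset {v : V // v ≠ z}) (hA'card : A'.card = a) (hB : BipSub (del D z) A')
    (hm' : (del D z).edgeFinset.card + deg D z = a * (Fintype.card {v : V // v ≠ z} - a))
    (hcap : ∀ v, deg D v ≤ (Fintype.card V - a - 2) + 1) :
    (∃ A : Finset V, A.card = a ∧ BipSub D A) ∨
      (∑ v, deg D v * deg D v + a * (Fintype.card V - 1 - a) + 2 * (Fintype.card V - a - 3) ≤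
        D.edgeFinset.card * Fintype.card V) ∨
      (2 ≤ deg D z ∧
        ∑ w : {v : V // v ≠ z}, (if D.Adj w.1 z then deg (del D z) w else 0) + (Fintype.card V - a - 2) ≤
          deg D z * (Fintype.card V - a - 2) + a) := by
  have hcard' := card_del z
  have hcapz : deg D z + a ≤ Fintype.card V := by have := hcap z; omega
  by_cases hall : ∀ w : {v : V // v ≠ z}, D.Adj w.1 z → w ∈ A'
  · obtain ⟨B, hBcard, hBsub⟩ := bipSub_lift D z A' hB hall
    exact Or.inl ⟨B, by rw [hBcard, hA'card], hBsub⟩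
  by_cases hnone : ∀ w : {v : V // v ≠ z}, D.Adj w.1 z → w ∉ A'
  · right; left
    push Not at hall
    obtain ⟨w₀, hw₀z, _⟩ := hall
    have hz1 : 1 ≤ deg D z := by
      have := card_nbhd_del D z
      have hmem : w₀ ∈ univ.filter (fun w : {v : V // v ≠ z} => D.Adj w.1 z) := by
        rw [mem_filter]; exact ⟨mem_univ _, hw₀z⟩
      have := card_pos.mpr ⟨w₀, hmem⟩
      omega
    have hAsub := bipSub_insert_map D z A' hB hnone
    have hAcard := card_insert_map z A'
    rw [hA'card] at hAcard
    obtain ⟨p, q, hp, hq, hpq⟩ := exists_missing_pair (del D z) A' hB a (deg D z) hA'card hm' hz1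
    obtain ⟨w₁, w₂, h12, hw₁, hw₂, hw₁z, hw₂z⟩ := exists_two_nonnbhd_off D z A' (by omega)
    have hns := not_missingStar_insert D z A' p q hp hq (fun h => hpq ((del_adj D z p q).mpr h)) w₁ w₂ h12 hw₁ hw₂
      hw₁z hw₂z
    have hedges : D.edgeFinset.card + (Fintype.card V - a - 1) = (a + 1) * (Fintype.card V - (a + 1)) := by
      have h := below_bip_edges a a (Fintype.card V) D.edgeFinset.card (by omega) hm
      have e : Fintype.card V - 2 * a - 1 + a = Fintype.card V - a - 1 := by omega
      rw [e] at h
      exact h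
    have h := closed_form_stability_bipSub D _ hAsub (a + 1) (Fintype.card V - a - 1) hAcard hedges (by omega)
      (by omega) hns
    have e : Fintype.card V - 1 - (Fintype.card V - a - 1) = a := by omega
    rw [e] at h
    have e2 : (Fintype.card V - a - 1) * a = a * (Fintype.card V - 1 - a) := by
      rw [mul_comm]; congr 1; omega
    rw [e2] at h
    omega
  · right; right
    push Not at hall hnone
    obtain ⟨w₀, hw₀z, hw₀A⟩ := hall
    obtain ⟨w₁, hw₁z, hw₁A⟩ := hnone
    have hne : w₀ ≠ w₁ := fun h => hw₀A (h ▸ hw₁A)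
    obtain ⟨Nz, hNzdef⟩ : ∃ Nz : Finset {v : V // v ≠ z},
        Nz = univ.filter (fun w : {v : V // v ≠ z} => D.Adj w.1 z) := ⟨_, rfl⟩
    have hmemNz : ∀ w : {v : V // v ≠ z}, w ∈ Nz ↔ D.Adj w.1 z := fun w => by
      rw [hNzdef, mem_filter]
      simp only [mem_univ, true_and]
    have hNz : Nz.card = deg D z := by rw [hNzdef]; exact card_nbhd_del D z
    refine ⟨?_, ?_⟩
    · have hsub : ({w₀, w₁} : Finset {v : V // v ≠ z}) ⊆ Nz := by
        intro w hw
        rw [mem_insert, mem_singleton] at hw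
        rcases hw with rfl | rfl
        · exact (hmemNz _).mpr hw₀z
        · exact (hmemNz _).mpr hw₁z
      have := card_le_card hsub
      rw [card_pair hne] at this
      omega
    · have hTfilt : ∑ w : {v : V // v ≠ z}, (if D.Adj w.1 z then deg (del D z) w else 0) =
          ∑ w ∈ Nz, deg (del D z) w := by
        rw [hNzdef, sum_filter]
      rw [hTfilt, ← hNz]
      have hdw₀ : deg (del D z) w₀ ≤ a := by
        have := deg_le_card_of_bipSub (del D z) A' hB w₀ hw₀A
        rw [hA'card] at this
        exact this
      exact sum_le_of_mem_le_gen Nz (fun w => deg (del D z) w) (Fintype.card V - a - 2) a ((hmemNz w₀).mpr hw₀z)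
        (fun w hw => by
          have h := deg_del D z w
          rw [if_pos ((hmemNz w).mp hw)] at h
          have := hcap w.1
          omega) hdw₀

/-- `d = 0`: `D − z` on the diagonal `(k − 1, a, 0)` at the gap `2a (k − 2a − 2)`: slack `16 + 8c + 12q + 2qc + 2q²`
(`a = q + 5`, `k = 3a + c`). -/
theorem rowA_del_zero (a k m' S' T : ℕ) (ha : 5 ≤ a) (hk : 3 * a ≤ k) (hmd : m' + 0 + a = a * (k - a))
    (hgap : S' + 2 * a * (k - 1 - 2 * a - 1) ≤ m' * (k - 1)) (hT : T ≤ 0 * (k - a - 2)) :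
    S' + 2 * T + 0 + 0 * 0 + a * (k - 1 - a) + 2 * (k - a - 3) ≤ (m' + 0) * k := by
  obtain ⟨q, rfl⟩ : ∃ q, a = q + 5 := ⟨a - 5, by omega⟩
  obtain ⟨c, rfl⟩ : ∃ c, k = 3 * (q + 5) + c := ⟨k - 3 * (q + 5), by omega⟩
  have e1 : 3 * (q + 5) + c - 1 - 2 * (q + 5) - 1 = q + 3 + c := by omega
  have e2 : 3 * (q + 5) + c - 1 = 3 * q + 14 + c := by omega
  have e3 : 3 * (q + 5) + c - 1 - (q + 5) = 2 * q + 9 + c := by omega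
  have e4 : 3 * (q + 5) + c - (q + 5) - 3 = 2 * q + 7 + c := by omega
  have e5 : 3 * (q + 5) + c - (q + 5) = 2 * q + 10 + c := by omega
  rw [e1, e2] at hgap
  rw [e3, e4]
  rw [e5] at hmd
  have hT0 : T = 0 := by omega
  subst hT0
  nlinarith [hgap, hmd]

/-- `1 ≤ d ≤ a − 3`: `D − z` on the `B2` cell `(k − 1, a, d)`: slack `2e (6 + c − e + 2q)` (`d = a − 1 − e`). -/
theorem rowA_del_B2 (a d k m' S' T : ℕ) (ha : 5 ≤ a) (hd1 : 1 ≤ d) (hda : d + 3 ≤ a) (hk : 3 * a ≤ k)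
    (hmd : m' + d + a = a * (k - a))
    (hgap : S' + d * (k - 1 - 1 - d) + 2 * (k - 1 - 2 * a - 1) * (a - d) ≤ m' * (k - 1))
    (hT : T ≤ d * (k - a - 2)) :
    S' + 2 * T + d + d * d + a * (k - 1 - a) + 2 * (k - a - 3) ≤ (m' + d) * k := by
  obtain ⟨q, rfl⟩ : ∃ q, a = q + 5 := ⟨a - 5, by omega⟩
  obtain ⟨e, he⟩ : ∃ e, d + e = q + 4 := ⟨q + 4 - d, by omega⟩
  have he2 : e ≤ q + 3 := by omega
  obtain ⟨c, rfl⟩ : ∃ c, k = 3 * (q + 5) + c := ⟨k - 3 * (q + 5), by omega⟩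
  have e1 : 3 * (q + 5) + c - 1 - 1 - d = 2 * q + 9 + c + e := by omega
  have e2 : 3 * (q + 5) + c - 1 - 2 * (q + 5) - 1 = q + 3 + c := by omega
  have e3 : q + 5 - d = e + 1 := by omega
  have e4 : 3 * (q + 5) + c - 1 = 3 * q + 14 + c := by omega
  have e5 : 3 * (q + 5) + c - (q + 5) - 2 = 2 * q + 8 + c := by omega
  have e6 : 3 * (q + 5) + c - 1 - (q + 5) = 2 * q + 9 + c := by omega
  have e7 : 3 * (q + 5) + c - (q + 5) - 3 = 2 * q + 7 + c := by omega
  have e8 : 3 * (q + 5) + c - (q + 5) = 2 * q + 10 + c := by omega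
  rw [e1, e2, e3, e4] at hgap
  rw [e5] at hT
  rw [e6, e7]
  rw [e8] at hmd
  have hee : e * e ≤ e * (q + 3) := Nat.mul_le_mul_left e he2
  nlinarith [hgap, hT, hmd, hee, he]

/-- `d = a − 2`: `D − z` on the `T` cell `(k − 1, a, a − 2)` at the gap `2 (k − 2a − 2)`: slack `4 + 2q`. -/
theorem rowA_del_T (a k m' S' T : ℕ) (ha : 5 ≤ a) (hk : 3 * a ≤ k) (hmd : m' + (a - 2) + a = a * (k - a))
    (hgap : S' + (a - 2) * (k - 1 - 1 - (a - 2)) + 2 * (k - 1 - 2 * a - 1) ≤ m' * (k - 1))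
    (hT : T ≤ (a - 2) * (k - a - 2)) :
    S' + 2 * T + (a - 2) + (a - 2) * (a - 2) + a * (k - 1 - a) + 2 * (k - a - 3) ≤ (m' + (a - 2)) * k := by
  obtain ⟨q, rfl⟩ : ∃ q, a = q + 5 := ⟨a - 5, by omega⟩
  obtain ⟨c, rfl⟩ : ∃ c, k = 3 * (q + 5) + c := ⟨k - 3 * (q + 5), by omega⟩
  have e0 : q + 5 - 2 = q + 3 := by omega
  have e1 : 3 * (q + 5) + c - 1 - 1 - (q + 3) = 2 * q + 10 + c := by omega
  have e2 : 3 * (q + 5) + c - 1 - 2 * (q + 5) - 1 = q + 3 + c := by omega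
  have e4 : 3 * (q + 5) + c - 1 = 3 * q + 14 + c := by omega
  have e5 : 3 * (q + 5) + c - (q + 5) - 2 = 2 * q + 8 + c := by omega
  have e6 : 3 * (q + 5) + c - 1 - (q + 5) = 2 * q + 9 + c := by omega
  have e7 : 3 * (q + 5) + c - (q + 5) - 3 = 2 * q + 7 + c := by omega
  have e8 : 3 * (q + 5) + c - (q + 5) = 2 * q + 10 + c := by omega
  rw [e0] at hgap hT hmd ⊢
  rw [e1, e2, e4] at hgap
  rw [e5] at hT
  rw [e6, e7]
  rw [e8] at hmd
  nlinarith [hgap, hT, hmd]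

/-- `d = a − 1`: `D − z` on the `B2` cell `(k − 1, a, a − 1)` at the gap `2 (k − 2a − 2)`: slack `0`. -/
theorem rowA_del_B (a k m' S' T : ℕ) (ha : 5 ≤ a) (hk : 3 * a ≤ k) (hmd : m' + (a - 1) + a = a * (k - a))
    (hgap : S' + (a - 1) * (k - 1 - 1 - (a - 1)) + 2 * (k - 1 - 2 * a - 1) ≤ m' * (k - 1))
    (hT : T ≤ (a - 1) * (k - a - 2)) :
    S' + 2 * T + (a - 1) + (a - 1) * (a - 1) + a * (k - 1 - a) + 2 * (k - a - 3) ≤ (m' + (a - 1)) * k := by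
  obtain ⟨q, rfl⟩ : ∃ q, a = q + 5 := ⟨a - 5, by omega⟩
  obtain ⟨c, rfl⟩ : ∃ c, k = 3 * (q + 5) + c := ⟨k - 3 * (q + 5), by omega⟩
  have e0 : q + 5 - 1 = q + 4 := by omega
  have e1 : 3 * (q + 5) + c - 1 - 1 - (q + 4) = 2 * q + 9 + c := by omega
  have e2 : 3 * (q + 5) + c - 1 - 2 * (q + 5) - 1 = q + 3 + c := by omega
  have e4 : 3 * (q + 5) + c - 1 = 3 * q + 14 + c := by omega
  have e5 : 3 * (q + 5) + c - (q + 5) - 2 = 2 * q + 8 + c := by omega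
  have e6 : 3 * (q + 5) + c - 1 - (q + 5) = 2 * q + 9 + c := by omega
  have e7 : 3 * (q + 5) + c - (q + 5) - 3 = 2 * q + 7 + c := by omega
  have e8 : 3 * (q + 5) + c - (q + 5) = 2 * q + 10 + c := by omega
  rw [e0] at hgap hT hmd ⊢
  rw [e1, e2, e4] at hgap
  rw [e5] at hT
  rw [e6, e7]
  rw [e8] at hmd
  nlinarith [hgap, hT, hmd]

/-- The mixed deletion, `2 ≤ d ≤ a − 1`, `D − z` `a`-bipartite on `(k − 1, a, d)`: slack `2e (3 + q − e)`. -/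
theorem rowA_mixed (a d k m' S' T : ℕ) (ha : 5 ≤ a) (hd2 : 2 ≤ d) (hda : d + 1 ≤ a) (hk : 3 * a ≤ k)
    (hmd : m' + d + a = a * (k - a)) (hS' : S' + d * (k - 1 - 1 - d) ≤ m' * (k - 1))
    (hT : T + (k - a - 2) ≤ d * (k - a - 2) + a) :
    S' + 2 * T + d + d * d + a * (k - 1 - a) + 2 * (k - a - 3) ≤ (m' + d) * k := by
  obtain ⟨q, rfl⟩ : ∃ q, a = q + 5 := ⟨a - 5, by omega⟩
  obtain ⟨e, he⟩ : ∃ e, d + e = q + 4 := ⟨q + 4 - d, by omega⟩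
  have he2 : e ≤ q + 2 := by omega
  obtain ⟨c, rfl⟩ : ∃ c, k = 3 * (q + 5) + c := ⟨k - 3 * (q + 5), by omega⟩
  have e1 : 3 * (q + 5) + c - 1 - 1 - d = 2 * q + 9 + c + e := by omega
  have e4 : 3 * (q + 5) + c - 1 = 3 * q + 14 + c := by omega
  have e5 : 3 * (q + 5) + c - (q + 5) - 2 = 2 * q + 8 + c := by omega
  have e6 : 3 * (q + 5) + c - 1 - (q + 5) = 2 * q + 9 + c := by omega
  have e7 : 3 * (q + 5) + c - (q + 5) - 3 = 2 * q + 7 + c := by omega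
  have e8 : 3 * (q + 5) + c - (q + 5) = 2 * q + 10 + c := by omega
  rw [e1, e4] at hS'
  rw [e5] at hT
  rw [e6, e7]
  rw [e8] at hmd
  have hee : e * e ≤ e * (q + 3) := Nat.mul_le_mul_left e (by omega)
  nlinarith [hS', hT, hmd, hee, he]

end C047

end TriangleCap

end PercRepro
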